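import Literature.Barriers.CriticalPhenomena.PlaquetteWalkDominoRigidityVertical
import Literature.Barriers.CriticalPhenomena.PlaquetteWalkDominoIdentity
import HarnessLib

/-!
# Barrier catalogue (SAWScalingLimit): the VERTICAL domino identities of the directed branches of the
five-weight plaquette walk on `ℤ²`

Companion of `PlaquetteWalkDominoIdentity` (horizontal dominoes `{f, f + (1,0)}`): the same two-plaquette
template for the VERTICAL domino `{f, f↑ = f + (0,1)}` with its seven sides in the slot order
`(f.S, f.W, f.E, shared = f.N = f↑.S, f↑.W, f↑.E, f↑.N) ↦ (0, …, 6)` — `ExactDominoVertexRelationV W t c`.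
On the directed branches the vertical identities hold with the SAME two closed-form vectors as the
horizontal ones, exchanged: on `{u₁ = 0}` with `branchDominoCoeffMirror u₂ v t = (v t K₊, −2u₂ v, −u₂ K₋,
t K₋ K₊, −u₂ K₋, −2u₂ v, v t K₊)`, `K± = u₂² − v² ± 1`, and on `{u₂ = 0}` with `branchDominoCoeff u₁ v t =
(v K₊, −u₁ t K₋, −2u₁ v t, K₋ K₊, −2u₁ v t, −u₁ t K₋, v K₊)`, `K± = u₁² − v² ± 1` (the diagonal reflection of
the lattice exchanges horizontal and vertical dominoes and the two corner kinds and reverses the phase).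
Contents: `north`, `dominoSlotV`, `dominoFunctionalV`, `ExactDominoVertexRelationV`, the splitting
`dominoFunctionalV_eq_add`, the six vertical two-plaquette rows `DominoRowsV` (plaquette rows of the dressed
vectors `dressDown` / `dressUp`), written out on both branches, the transfer identities through the
vertical shared side (`sum_fresh_sharedV_eq`, `…_mirror` — copies of the horizontal ones, the grouping at
`f↑` by its south side), ★★ `exactDominoVertexRelationV_of_dominoRowsV` (+ mirror),
`exactDominoVertexRelationV_branch` / `…_mirrorBranch`, the named `PlaquetteWalkDominoIdentityVertical(_holds)`,
and `dominoV_not_plaquette(_mirror)` (vertical domino class ⊋ plaquette class on both hyperplanes, off the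
quartics). With this file all four identities of HOME/FINDING-Z2-DOMINO-CLASS.md Result 1 are kernel
theorems.

Sources: [cite: GlazmanManolescu2019, §1 Fig. 1, eq. (1); §2.1 eq. (2.1); Lemma 2.1]; [cite:
DuminilCopinSmirnov2012, Lemma 1]; [cite: Glazman2015WeightedSAW, Lemma 3.1 (proof, eq. (3.11))];
[cite: JansevanRensburg2015, §4.6 (Temperley method for partially directed walks, eq. (4.197), Fig. 4.24)].
Status in print: as for the horizontal file — mechanism CONSOLIDATION (folklore transfer recursions), the
typed statements the venture lane's («pcv-sawmu», Tier B SEARCH 1, b-engine-1 gen 14). Implementation: the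
private grouping lemmas of `PlaquetteWalkDegenerateIdentity` are read via `open private … from`.

(Architecture: the walk-free half — `ExactDominoVertexRelationV`, `DominoRowsV`, the closed forms on the branches, the
NECESSITY of the vertical rows for every weight system and the vertical generic triviality — is
`PlaquetteWalkDominoRigidityVertical`; this file is the walk half: transfer through the vertical shared
side, SUFFICIENCY of the rows on the directed branches, the identities, and the two-sided classification.)
-/

noncomputable section

open Complex

namespace Literature.Barriers.CriticalPhenomena

open Literature.Probability.RandomPlanarGeometry.SAW.YangBaxter

namespace PlaquetteWalk

/-! ## The walk part: transfer through the vertical shared side, and the identities -/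

section Vertical

open ΩF

open private ext_fst ext_snd_arcs ext_snd_nth ext_snd_length mem_admSet adm_of_no_arc quarterTurnsL_of_snoc
  qTurnOf_side_side
  from Literature.Barriers.CriticalPhenomena.PlaquetteWalkDegenerateIdentity

variable {D : Set Face} {a z : MidEdge} {Dl : List Face} {f₀ : Face} {W : CWeights} {t : ℂ}

/-! ### Transfer through the vertical shared side -/

variable {f : Face}

/-- The lower face of the vertical shared side is `f`. [cite: GlazmanManolescu2019, §2.1 (walks of a finite domain started at a boundary mid-edge)] -/
theorem faces_sharedV_fst (f : Face) : (f.side .N).faces.1 = f := by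
  obtain ⟨x, y⟩ := f
  simp [Face.side, MidEdge.faces]

/-- The upper face of the vertical shared side is `f↑ = north f`. [cite: GlazmanManolescu2019, §2.1 (walks of a finite domain started at a boundary mid-edge)] -/
theorem faces_sharedV_snd (f : Face) : (f.side .N).faces.2 = north f := rfl

/-- The shared side of a vertical domino inside the face list is not a boundary root. [cite: GlazmanManolescu2019, §2.1 (walks start on the boundary of the domain)] -/
theorem ne_sharedV_of_isBoundaryRoot (hf : f ∈ Dl) (hf' : north f ∈ Dl) (ha : IsBoundaryRoot Dl a) :
    a ≠ f.side .N := by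
  rintro rfl
  rcases ha with ⟨-, h2⟩ | ⟨h1, -⟩
  · exact h2 (by rw [faces_sharedV_snd]; exact hf')
  · exact h1 (by rw [faces_sharedV_fst]; exact hf)

/-- A walk from a boundary root to the vertical shared side has an arc. [cite: GlazmanManolescu2019, §2.1 (walks of a finite domain started at a boundary mid-edge)] -/
theorem arcs_length_pos_of_sharedV (hf : f ∈ Dl) (hf' : north f ∈ Dl) (ha : IsBoundaryRoot Dl a)
    (γ : YBWalk (dom Dl) a (f.side .N)) : 0 < γ.arcs.length := by
  by_contra h0
  have h0' : γ.arcs.length = 0 := by omega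
  have e1 := γ.nth_length
  rw [h0', YBWalk.nth_zero] at e1
  exact ne_sharedV_of_isBoundaryRoot hf hf' ha e1

/-- The last arc of a walk ending at the vertical shared side lies in `f` or in `f↑`. [cite: GlazmanManolescu2019, §2.1 (walks of a finite domain started at a boundary mid-edge)] -/
theorem last_arcFace_sharedV (γ : YBWalk (dom Dl) a (f.side .N)) (hn : 0 < γ.arcs.length) :
    arcFace (γ.nth (γ.arcs.length - 1), γ.nth γ.arcs.length) = some f ∨
      arcFace (γ.nth (γ.arcs.length - 1), γ.nth γ.arcs.length) = some (north f) := by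
  obtain ⟨g, -, hg⟩ := γ.arc_nth (show γ.arcs.length - 1 < γ.arcs.length by omega)
  rw [show γ.arcs.length - 1 + 1 = γ.arcs.length by omega] at hg
  have h2 := (MidEdge.commonFace_eq_some hg).2.2
  rw [YBWalk.nth_length, faces_sharedV_fst, faces_sharedV_snd] at h2
  rcases h2 with rfl | rfl
  · exact Or.inl hg
  · exact Or.inr hg

/-- A walk at the vertical shared side that has not crossed `f` is of the extension class at `f↑` (its last
arc lies in `f↑`). [cite: GlazmanManolescu2019, §2.1 (walks of a finite domain started at a boundary mid-edge)] -/
theorem isExt_north_of_kindsIn_eq_nil (hf : f ∈ Dl) (hf' : north f ∈ Dl) (ha : IsBoundaryRoot Dl a)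
    (γ : YBWalk (dom Dl) a (f.side .N)) (hK : γ.kindsIn f = []) :
    ΩF.IsExt (⟨.S, γ⟩ : ΩF Dl a (north f)) := by
  have hn := arcs_length_pos_of_sharedV hf hf' ha γ
  refine ⟨hn, ?_⟩
  rcases last_arcFace_sharedV γ hn with h | h
  · exact absurd h (by
      have := no_arc_of_kindsIn_eq_nil γ hK (γ.arcs.length - 1) (by omega)
      rwa [show γ.arcs.length - 1 + 1 = γ.arcs.length by omega] at this)
  · have e : γ.nth γ.arcs.length = (north f).side .S := γ.nth_length
    rw [e] at h
    exact h

/-- A walk at the vertical shared side that has not crossed `f` is an arrival at `f`.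
[cite: GlazmanManolescu2019, §2.1 (walks of a finite domain started at a boundary mid-edge)] -/
theorem not_isExtV_of_kindsIn_eq_nil (γ : YBWalk (dom Dl) a (f.side .N)) (hK : γ.kindsIn f = []) :
    ¬ΩF.IsExt (⟨.N, γ⟩ : ΩF Dl a f) := by
  rintro ⟨hn, h⟩
  have hn' : 0 < γ.arcs.length := hn
  have := no_arc_of_kindsIn_eq_nil γ hK (γ.arcs.length - 1) (by omega)
  rw [show γ.arcs.length - 1 + 1 = γ.arcs.length by omega] at this
  exact this (by simpa using h)

/-- ★ **Transfer through the vertical shared side** (`u₁ = 0`): the fresh arrivals at `f` through its north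
side, weighted by exterior weight × phase, equal the fresh OUTSIDE arrivals at `f↑`, weighted by exterior
weight × phase × (one-arc weight into the south side of `f↑`). Mechanism: the former are exactly the
one-arc extensions into the shared side of the latter (the `base`/`ext` bijection of the grouping at
`f↑`); an extension that had crossed `f` before, or whose arrival had crossed `f↑` before, is a returning
walk, not corner-free, of weight `0`. [cite: Glazman2015WeightedSAW, Lemma 3.1 (proof: walks in a group differ only inside the rhombus)] -/
theorem sum_fresh_sharedV_eq (ht : t ≠ 0) (h1 : W.u₁ = 0) (hf : f ∈ Dl) (hf' : north f ∈ Dl)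
    (ha : IsBoundaryRoot Dl a) :
    (∑ ω ∈ setArr Dl a f, if ω.2.kindsIn f = [] ∧ ω.1 = .N then extW W ω.2 f * t ^ quarterTurnsL ω.2.mids
      else 0) =
    ∑ ω ∈ setArr Dl a (north f), if ω.2.kindsIn (north f) = [] ∧ ω.1 ≠ .S then
      extW W ω.2 (north f) * t ^ quarterTurnsL ω.2.mids * (arcW W (arcKind ω.1 .S) * t ^ qTurn ω.1 .S)
      else 0 := by
  classical
  -- Step 1: the left side as a sum over all walks ending at the shared side
  have hL : (∑ ω ∈ setArr Dl a f, if ω.2.kindsIn f = [] ∧ ω.1 = .N then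
      extW W ω.2 f * t ^ quarterTurnsL ω.2.mids else 0) =
      ∑ γ : YBWalk (dom Dl) a (f.side .N), if γ.kindsIn f = [] then wt W t γ else 0 := by
    have e1 : (∑ ω ∈ setArr Dl a f, if ω.2.kindsIn f = [] ∧ ω.1 = .N then
        extW W ω.2 f * t ^ quarterTurnsL ω.2.mids else 0) =
        ∑ ω : ΩF Dl a f, if ω.2.kindsIn f = [] ∧ ω.1 = .N then wt W t ω.2 else 0 := by
      rw [setArr, Finset.sum_filter]
      refine Finset.sum_congr rfl fun ω _ => ?_
      by_cases hc : ω.2.kindsIn f = [] ∧ ω.1 = .N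
      · obtain ⟨s, γ⟩ := ω
        obtain ⟨hK, hs⟩ := hc
        simp only at hs
        subst hs
        rw [if_pos (not_isExtV_of_kindsIn_eq_nil γ hK), if_pos (show γ.kindsIn f = [] ∧ Side.N = Side.N from ⟨hK, rfl⟩),
          if_pos (show γ.kindsIn f = [] ∧ Side.N = Side.N from ⟨hK, rfl⟩), wt,
          weightL_eq_extW_mul W γ f, hK, locW_nil, mul_one]
      · rw [if_neg hc]
        split_ifs <;> rfl
    rw [e1, Fintype.sum_sigma]
    rw [Fintype.sum_eq_single Side.N (fun s hs => by
      refine Finset.sum_eq_zero fun γ _ => ?_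
      rw [if_neg (fun hc => hs hc.2)])]
    refine Finset.sum_congr rfl fun γ _ => ?_
    by_cases hK : γ.kindsIn f = []
    · rw [if_pos (show γ.kindsIn f = [] ∧ Side.N = Side.N from ⟨hK, rfl⟩), if_pos hK]
    · rw [if_neg (show ¬(γ.kindsIn f = [] ∧ Side.N = Side.N) from fun hc => hK hc.1), if_neg hK]
  -- Step 2: the same sum through the extension class at `f⁺`
  set G : ΩF Dl a (north f) → ℂ := fun ω => if ω.1 = .S ∧ ω.2.kindsIn f = [] then wt W t ω.2 else 0
    with hG
  have hLM : (∑ γ : YBWalk (dom Dl) a (f.side .N), if γ.kindsIn f = [] then wt W t γ else 0) =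
      ∑ γ : YBWalk (dom Dl) a ((north f).side .S), if γ.kindsIn f = [] then wt W t γ else 0 := rfl
  have hM : (∑ γ : YBWalk (dom Dl) a ((north f).side .S), if γ.kindsIn f = [] then wt W t γ else 0) =
      ∑ ω ∈ setExt Dl a (north f), G ω := by
    rw [setExt, Finset.sum_filter, Fintype.sum_sigma]
    rw [Fintype.sum_eq_single Side.S (fun s hs => by
      refine Finset.sum_eq_zero fun γ _ => ?_
      rw [hG]
      beta_reduce
      rw [if_neg (show ¬(s = Side.S ∧ γ.kindsIn f = []) from fun hc => hs hc.1)]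
      split_ifs <;> rfl)]
    refine Finset.sum_congr rfl fun γ _ => ?_
    rw [hG]
    beta_reduce
    by_cases hK : γ.kindsIn f = []
    · rw [if_pos hK, if_pos (isExt_north_of_kindsIn_eq_nil hf hf' ha γ hK),
        if_pos (show Side.S = Side.S ∧ γ.kindsIn f = [] from ⟨rfl, hK⟩)]
    · rw [if_neg hK]
      split_ifs with h1' h2'
      · exact absurd h2'.2 hK
      · rfl
      · rfl
  rw [hL, hLM, hM, sum_ext hf' G]
  -- Step 3: compare group by group over the arrivals at `f⁺`
  refine Finset.sum_congr rfl fun ω hω => ?_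
  have h : ¬ω.IsExt := by simpa [setArr] using hω
  -- the extension into the shared side, when admissible: its label, weight and corner-freeness
  have hextW : ω.Adm .S → (ω.ext hf' .S).1 = .S ∧
      wt W t (ω.ext hf' .S).2 = extW W ω.2 (north f) * locW W (ω.2.kindsIn (north f) ++ [arcKind ω.1 .S]) *
        (t ^ quarterTurnsL ω.2.mids * t ^ qTurn ω.1 .S) := by
    intro hx
    have harcs := ext_snd_arcs hf' h hx
    have hpx : ω.1 ≠ .S := Ne.symm hx.1
    have hfa : arcFace ((north f).side ω.1, (north f).side .S) = some (north f) :=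
      arcFace_side_side (north f) ω.1 .S hpx
    refine ⟨ext_fst hf' h hx, ?_⟩
    rw [wt, weightL_eq_extW_mul W _ (north f), extW_of_snoc W ω.2 _ (north f) harcs hfa,
      YBWalk.kindsIn_of_snoc ω.2 _ (north f) harcs hfa, arcKindOf_eq hfa (s := ω.1) (t := Side.S) rfl rfl,
      quarterTurnsL_of_snoc ω.2 _ harcs, qTurnOf_side_side (north f) hpx, zpow_add₀ ht]
    simp only [List.reduceOption_cons_of_some, List.reduceOption_nil]
  -- the inner sum over the admissible sides is the single term `x = S` (if admissible)
  have hinner : (∑ x ∈ ω.admSet, G (ω.ext hf' x)) =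
      if ω.Adm .S then (if (ω.ext hf' .S).2.kindsIn f = [] then wt W t (ω.ext hf' .S).2 else 0) else 0 := by
    by_cases hW : ω.Adm .S
    · rw [if_pos hW, Finset.sum_eq_single_of_mem Side.S (mem_admSet.2 hW) (fun x hx hxW => by
        have hx' : ω.Adm x := mem_admSet.1 hx
        rw [hG]
        beta_reduce
        rw [if_neg (show ¬((ω.ext hf' x).1 = Side.S ∧ (ω.ext hf' x).2.kindsIn f = []) from
          fun hc => hxW ((ext_fst hf' h hx').symm.trans hc.1))])]
      rw [hG]
      beta_reduce
      have hδ1 : (ω.ext hf' .S).1 = .S := (hextW hW).1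
      by_cases hK : (ω.ext hf' .S).2.kindsIn f = []
      · rw [if_pos (show (ω.ext hf' Side.S).1 = Side.S ∧ (ω.ext hf' Side.S).2.kindsIn f = [] from ⟨hδ1, hK⟩),
          if_pos hK]
      · rw [if_neg (show ¬((ω.ext hf' Side.S).1 = Side.S ∧ (ω.ext hf' Side.S).2.kindsIn f = []) from
          fun hc => hK hc.2), if_neg hK]
    · rw [if_neg hW]
      refine Finset.sum_eq_zero fun x hx => ?_
      have hx' : ω.Adm x := mem_admSet.1 hx
      have hxW : x ≠ .S := fun e => hW (e ▸ hx')
      rw [hG]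
      beta_reduce
      rw [if_neg (show ¬((ω.ext hf' x).1 = Side.S ∧ (ω.ext hf' x).2.kindsIn f = []) from
        fun hc => hxW ((ext_fst hf' h hx').symm.trans hc.1))]
  rw [hinner]
  by_cases hK' : ω.2.kindsIn (north f) = []
  · have hno : ∀ i < ω.2.arcs.length, arcFace (ω.2.nth i, ω.2.nth (i + 1)) ≠ some (north f) :=
      no_arc_of_kindsIn_eq_nil ω.2 hK'
    by_cases hp : ω.1 = .S
    · -- the arrival came through the shared side itself: no extension back into it, no outside row
      have hnA : ¬ω.Adm .S := fun hx => hx.1 hp.symm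
      rw [if_neg hnA, if_neg (show ¬(ω.2.kindsIn (north f) = [] ∧ ω.1 ≠ Side.S) from fun hc => hc.2 hp)]
    · have hA : ω.Adm .S := adm_of_no_arc hf' ha h hno (Ne.symm hp)
      obtain ⟨-, hwt⟩ := hextW hA
      rw [hK', List.nil_append, locW_single] at hwt
      rw [if_pos hA, if_pos (show ω.2.kindsIn (north f) = [] ∧ ω.1 ≠ Side.S from ⟨hK', hp⟩)]
      by_cases hK : (ω.ext hf' .S).2.kindsIn f = []
      · rw [if_pos hK, hwt]; ring
      · -- the extended walk had crossed `f` before reaching the shared side: a return, weight `0`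
        rw [if_neg hK]
        have hδ1 : (ω.ext hf' .S).1 = .S := (hextW hA).1
        have hz : (north f).side (ω.ext hf' .S).1 = f.side .N := by rw [hδ1]; rfl
        set δ := (ω.ext hf' .S).2 with hδ
        -- `δ'`: the extended walk as an arrival at `f` labelled `N`
        have hδ'arcs : (δ.cast rfl hz).arcs = δ.arcs := by
          show arcsOf (δ.cast rfl hz).mids = arcsOf δ.mids
          rw [YBWalk.cast_mids]
        have hδ'nth : ∀ i, (δ.cast rfl hz).nth i = δ.nth i := by
          intro i
          rw [YBWalk.nth, YBWalk.cast_mids, ← YBWalk.nth]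
        have hδ'K : (δ.cast rfl hz).kindsIn f = δ.kindsIn f := by
          rw [YBWalk.kindsIn_eq, YBWalk.kindsIn_eq, hδ'arcs]
        have hlen : δ.arcs.length = ω.2.arcs.length + 1 := ext_snd_length hf' h hA
        have hlast : ¬ΩF.IsExt (⟨.N, δ.cast rfl hz⟩ : ΩF Dl a f) := by
          rintro ⟨hn, hface⟩
          simp only at hface
          rw [hδ'arcs, hδ'nth, hlen, Nat.add_sub_cancel, hδ, ext_snd_nth hf' h hA le_rfl,
            YBWalk.nth_length] at hface
          have hfa : arcFace ((north f).side ω.1, (north f).side .S) = some (north f) :=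
            arcFace_side_side (north f) ω.1 .S (Ne.symm hA.1)
          have hfe : north f = f := Option.some_injective _ (hfa.symm.trans hface)
          have := congrArg Prod.snd hfe
          simp [north] at this
        have hncf : ¬CornerFree δ := by
          intro hcf
          have hcf' : CornerFree (δ.cast rfl hz) := by
            intro i hi
            rw [hδ'nth, hδ'nth]
            exact hcf i (by rw [← hδ'arcs]; exact hi)
          have hno := no_arc_of_cornerFree ⟨.N, δ.cast rfl hz⟩ hlast hcf'
          apply hK
          rw [← hδ'K]
          exact kindsIn_eq_nil_of_no_arc _ hno
        have hw0 : wt W t δ = 0 := by rw [wt, weightL_eq_zero_of_not_cornerFree h1 δ hncf, zero_mul]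
        rw [hw0] at hwt
        linear_combination hwt
  · -- the arrival had crossed `f↑` before: its extension is a return, weight `0`
    rw [if_neg (show ¬(ω.2.kindsIn (north f) = [] ∧ ω.1 ≠ Side.S) from fun hc => hK' hc.1)]
    by_cases hA : ω.Adm .S
    · rw [if_pos hA]
      split_ifs with hK
      · have hncf0 : ¬CornerFree ω.2 := by
          intro hcf
          apply hK'
          exact kindsIn_eq_nil_of_no_arc ω.2 (no_arc_of_cornerFree ω h hcf)
        have hncf : ¬CornerFree (ω.ext hf' .S).2 := by
          intro hcf
          apply hncf0
          intro i hi
          have hlen := ext_snd_length hf' h hA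
          have := hcf i (by rw [hlen]; omega)
          rwa [ext_snd_nth hf' h hA (by omega), ext_snd_nth hf' h hA (by omega)] at this
        rw [wt, weightL_eq_zero_of_not_cornerFree h1 _ hncf, zero_mul]
      · rfl
    · rw [if_neg hA]


/-- ★ **Transfer through the vertical shared side** (`u₂ = 0`; same statement, co-corners): the fresh arrivals at `f` through its north
side, weighted by exterior weight × phase, equal the fresh OUTSIDE arrivals at `f↑`, weighted by exterior
weight × phase × (one-arc weight into the south side of `f↑`). Mechanism: the former are exactly the
one-arc extensions into the shared side of the latter (the `base`/`ext` bijection of the grouping at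
`f↑`); an extension that had crossed `f` before, or whose arrival had crossed `f↑` before, is a returning
walk, not corner-free, of weight `0`. [cite: Glazman2015WeightedSAW, Lemma 3.1 (proof: walks in a group differ only inside the rhombus)] -/
theorem sum_fresh_sharedV_eq_mirror (ht : t ≠ 0) (h2 : W.u₂ = 0) (hf : f ∈ Dl) (hf' : north f ∈ Dl)
    (ha : IsBoundaryRoot Dl a) :
    (∑ ω ∈ setArr Dl a f, if ω.2.kindsIn f = [] ∧ ω.1 = .N then extW W ω.2 f * t ^ quarterTurnsL ω.2.mids
      else 0) =
    ∑ ω ∈ setArr Dl a (north f), if ω.2.kindsIn (north f) = [] ∧ ω.1 ≠ .S then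
      extW W ω.2 (north f) * t ^ quarterTurnsL ω.2.mids * (arcW W (arcKind ω.1 .S) * t ^ qTurn ω.1 .S)
      else 0 := by
  classical
  -- Step 1: the left side as a sum over all walks ending at the shared side
  have hL : (∑ ω ∈ setArr Dl a f, if ω.2.kindsIn f = [] ∧ ω.1 = .N then
      extW W ω.2 f * t ^ quarterTurnsL ω.2.mids else 0) =
      ∑ γ : YBWalk (dom Dl) a (f.side .N), if γ.kindsIn f = [] then wt W t γ else 0 := by
    have e1 : (∑ ω ∈ setArr Dl a f, if ω.2.kindsIn f = [] ∧ ω.1 = .N then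
        extW W ω.2 f * t ^ quarterTurnsL ω.2.mids else 0) =
        ∑ ω : ΩF Dl a f, if ω.2.kindsIn f = [] ∧ ω.1 = .N then wt W t ω.2 else 0 := by
      rw [setArr, Finset.sum_filter]
      refine Finset.sum_congr rfl fun ω _ => ?_
      by_cases hc : ω.2.kindsIn f = [] ∧ ω.1 = .N
      · obtain ⟨s, γ⟩ := ω
        obtain ⟨hK, hs⟩ := hc
        simp only at hs
        subst hs
        rw [if_pos (not_isExtV_of_kindsIn_eq_nil γ hK), if_pos (show γ.kindsIn f = [] ∧ Side.N = Side.N from ⟨hK, rfl⟩),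
          if_pos (show γ.kindsIn f = [] ∧ Side.N = Side.N from ⟨hK, rfl⟩), wt,
          weightL_eq_extW_mul W γ f, hK, locW_nil, mul_one]
      · rw [if_neg hc]
        split_ifs <;> rfl
    rw [e1, Fintype.sum_sigma]
    rw [Fintype.sum_eq_single Side.N (fun s hs => by
      refine Finset.sum_eq_zero fun γ _ => ?_
      rw [if_neg (fun hc => hs hc.2)])]
    refine Finset.sum_congr rfl fun γ _ => ?_
    by_cases hK : γ.kindsIn f = []
    · rw [if_pos (show γ.kindsIn f = [] ∧ Side.N = Side.N from ⟨hK, rfl⟩), if_pos hK]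
    · rw [if_neg (show ¬(γ.kindsIn f = [] ∧ Side.N = Side.N) from fun hc => hK hc.1), if_neg hK]
  -- Step 2: the same sum through the extension class at `f⁺`
  set G : ΩF Dl a (north f) → ℂ := fun ω => if ω.1 = .S ∧ ω.2.kindsIn f = [] then wt W t ω.2 else 0
    with hG
  have hLM : (∑ γ : YBWalk (dom Dl) a (f.side .N), if γ.kindsIn f = [] then wt W t γ else 0) =
      ∑ γ : YBWalk (dom Dl) a ((north f).side .S), if γ.kindsIn f = [] then wt W t γ else 0 := rfl
  have hM : (∑ γ : YBWalk (dom Dl) a ((north f).side .S), if γ.kindsIn f = [] then wt W t γ else 0) =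
      ∑ ω ∈ setExt Dl a (north f), G ω := by
    rw [setExt, Finset.sum_filter, Fintype.sum_sigma]
    rw [Fintype.sum_eq_single Side.S (fun s hs => by
      refine Finset.sum_eq_zero fun γ _ => ?_
      rw [hG]
      beta_reduce
      rw [if_neg (show ¬(s = Side.S ∧ γ.kindsIn f = []) from fun hc => hs hc.1)]
      split_ifs <;> rfl)]
    refine Finset.sum_congr rfl fun γ _ => ?_
    rw [hG]
    beta_reduce
    by_cases hK : γ.kindsIn f = []
    · rw [if_pos hK, if_pos (isExt_north_of_kindsIn_eq_nil hf hf' ha γ hK),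
        if_pos (show Side.S = Side.S ∧ γ.kindsIn f = [] from ⟨rfl, hK⟩)]
    · rw [if_neg hK]
      split_ifs with h1' h2'
      · exact absurd h2'.2 hK
      · rfl
      · rfl
  rw [hL, hLM, hM, sum_ext hf' G]
  -- Step 3: compare group by group over the arrivals at `f⁺`
  refine Finset.sum_congr rfl fun ω hω => ?_
  have h : ¬ω.IsExt := by simpa [setArr] using hω
  -- the extension into the shared side, when admissible: its label, weight and corner-freeness
  have hextW : ω.Adm .S → (ω.ext hf' .S).1 = .S ∧
      wt W t (ω.ext hf' .S).2 = extW W ω.2 (north f) * locW W (ω.2.kindsIn (north f) ++ [arcKind ω.1 .S]) *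
        (t ^ quarterTurnsL ω.2.mids * t ^ qTurn ω.1 .S) := by
    intro hx
    have harcs := ext_snd_arcs hf' h hx
    have hpx : ω.1 ≠ .S := Ne.symm hx.1
    have hfa : arcFace ((north f).side ω.1, (north f).side .S) = some (north f) :=
      arcFace_side_side (north f) ω.1 .S hpx
    refine ⟨ext_fst hf' h hx, ?_⟩
    rw [wt, weightL_eq_extW_mul W _ (north f), extW_of_snoc W ω.2 _ (north f) harcs hfa,
      YBWalk.kindsIn_of_snoc ω.2 _ (north f) harcs hfa, arcKindOf_eq hfa (s := ω.1) (t := Side.S) rfl rfl,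
      quarterTurnsL_of_snoc ω.2 _ harcs, qTurnOf_side_side (north f) hpx, zpow_add₀ ht]
    simp only [List.reduceOption_cons_of_some, List.reduceOption_nil]
  -- the inner sum over the admissible sides is the single term `x = S` (if admissible)
  have hinner : (∑ x ∈ ω.admSet, G (ω.ext hf' x)) =
      if ω.Adm .S then (if (ω.ext hf' .S).2.kindsIn f = [] then wt W t (ω.ext hf' .S).2 else 0) else 0 := by
    by_cases hW : ω.Adm .S
    · rw [if_pos hW, Finset.sum_eq_single_of_mem Side.S (mem_admSet.2 hW) (fun x hx hxW => by
        have hx' : ω.Adm x := mem_admSet.1 hx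
        rw [hG]
        beta_reduce
        rw [if_neg (show ¬((ω.ext hf' x).1 = Side.S ∧ (ω.ext hf' x).2.kindsIn f = []) from
          fun hc => hxW ((ext_fst hf' h hx').symm.trans hc.1))])]
      rw [hG]
      beta_reduce
      have hδ1 : (ω.ext hf' .S).1 = .S := (hextW hW).1
      by_cases hK : (ω.ext hf' .S).2.kindsIn f = []
      · rw [if_pos (show (ω.ext hf' Side.S).1 = Side.S ∧ (ω.ext hf' Side.S).2.kindsIn f = [] from ⟨hδ1, hK⟩),
          if_pos hK]
      · rw [if_neg (show ¬((ω.ext hf' Side.S).1 = Side.S ∧ (ω.ext hf' Side.S).2.kindsIn f = []) from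
          fun hc => hK hc.2), if_neg hK]
    · rw [if_neg hW]
      refine Finset.sum_eq_zero fun x hx => ?_
      have hx' : ω.Adm x := mem_admSet.1 hx
      have hxW : x ≠ .S := fun e => hW (e ▸ hx')
      rw [hG]
      beta_reduce
      rw [if_neg (show ¬((ω.ext hf' x).1 = Side.S ∧ (ω.ext hf' x).2.kindsIn f = []) from
        fun hc => hxW ((ext_fst hf' h hx').symm.trans hc.1))]
  rw [hinner]
  by_cases hK' : ω.2.kindsIn (north f) = []
  · have hno : ∀ i < ω.2.arcs.length, arcFace (ω.2.nth i, ω.2.nth (i + 1)) ≠ some (north f) :=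
      no_arc_of_kindsIn_eq_nil ω.2 hK'
    by_cases hp : ω.1 = .S
    · -- the arrival came through the shared side itself: no extension back into it, no outside row
      have hnA : ¬ω.Adm .S := fun hx => hx.1 hp.symm
      rw [if_neg hnA, if_neg (show ¬(ω.2.kindsIn (north f) = [] ∧ ω.1 ≠ Side.S) from fun hc => hc.2 hp)]
    · have hA : ω.Adm .S := adm_of_no_arc hf' ha h hno (Ne.symm hp)
      obtain ⟨-, hwt⟩ := hextW hA
      rw [hK', List.nil_append, locW_single] at hwt
      rw [if_pos hA, if_pos (show ω.2.kindsIn (north f) = [] ∧ ω.1 ≠ Side.S from ⟨hK', hp⟩)]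
      by_cases hK : (ω.ext hf' .S).2.kindsIn f = []
      · rw [if_pos hK, hwt]; ring
      · -- the extended walk had crossed `f` before reaching the shared side: a return, weight `0`
        rw [if_neg hK]
        have hδ1 : (ω.ext hf' .S).1 = .S := (hextW hA).1
        have hz : (north f).side (ω.ext hf' .S).1 = f.side .N := by rw [hδ1]; rfl
        set δ := (ω.ext hf' .S).2 with hδ
        -- `δ'`: the extended walk as an arrival at `f` labelled `N`
        have hδ'arcs : (δ.cast rfl hz).arcs = δ.arcs := by
          show arcsOf (δ.cast rfl hz).mids = arcsOf δ.mids
          rw [YBWalk.cast_mids]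
        have hδ'nth : ∀ i, (δ.cast rfl hz).nth i = δ.nth i := by
          intro i
          rw [YBWalk.nth, YBWalk.cast_mids, ← YBWalk.nth]
        have hδ'K : (δ.cast rfl hz).kindsIn f = δ.kindsIn f := by
          rw [YBWalk.kindsIn_eq, YBWalk.kindsIn_eq, hδ'arcs]
        have hlen : δ.arcs.length = ω.2.arcs.length + 1 := ext_snd_length hf' h hA
        have hlast : ¬ΩF.IsExt (⟨.N, δ.cast rfl hz⟩ : ΩF Dl a f) := by
          rintro ⟨hn, hface⟩
          simp only at hface
          rw [hδ'arcs, hδ'nth, hlen, Nat.add_sub_cancel, hδ, ext_snd_nth hf' h hA le_rfl,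
            YBWalk.nth_length] at hface
          have hfa : arcFace ((north f).side ω.1, (north f).side .S) = some (north f) :=
            arcFace_side_side (north f) ω.1 .S (Ne.symm hA.1)
          have hfe : north f = f := Option.some_injective _ (hfa.symm.trans hface)
          have := congrArg Prod.snd hfe
          simp [north] at this
        have hncf : ¬CoCornerFree δ := by
          intro hcf
          have hcf' : CoCornerFree (δ.cast rfl hz) := by
            intro i hi
            rw [hδ'nth, hδ'nth]
            exact hcf i (by rw [← hδ'arcs]; exact hi)
          have hno := no_arc_of_coCornerFree ⟨.N, δ.cast rfl hz⟩ hlast hcf'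
          apply hK
          rw [← hδ'K]
          exact kindsIn_eq_nil_of_no_arc _ hno
        have hw0 : wt W t δ = 0 := by rw [wt, weightL_eq_zero_of_not_coCornerFree h2 δ hncf, zero_mul]
        rw [hw0] at hwt
        linear_combination hwt
  · -- the arrival had crossed `f↑` before: its extension is a return, weight `0`
    rw [if_neg (show ¬(ω.2.kindsIn (north f) = [] ∧ ω.1 ≠ Side.S) from fun hc => hK' hc.1)]
    by_cases hA : ω.Adm .S
    · rw [if_pos hA]
      split_ifs with hK
      · have hncf0 : ¬CoCornerFree ω.2 := by
          intro hcf
          apply hK'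
          exact kindsIn_eq_nil_of_no_arc ω.2 (no_arc_of_coCornerFree ω h hcf)
        have hncf : ¬CoCornerFree (ω.ext hf' .S).2 := by
          intro hcf
          apply hncf0
          intro i hi
          have hlen := ext_snd_length hf' h hA
          have := hcf i (by rw [hlen]; omega)
          rwa [ext_snd_nth hf' h hA (by omega), ext_snd_nth hf' h hA (by omega)] at this
        rw [wt, weightL_eq_zero_of_not_coCornerFree h2 _ hncf, zero_mul]
      · rfl
    · rw [if_neg hA]


/-! ### The vertical domino identities -/

variable {c : Fin 7 → ℂ}

/-- ★★ **Six vanishing vertical rows ⇒ an exact vertical domino relation everywhere** (`u₁ = 0`). Same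
assembly as the horizontal case: split as `VF_f(dressDown c) + VF_{f↑}(c_E↑, c_N↑, c_W↑, γ₂)` with
`γ₂ = c_sh − innerUp`; fresh-arrival rows at both plaquettes; the arrivals through the shared side are
matched by `sum_fresh_sharedV_eq`. [cite: Glazman2015WeightedSAW, Lemma 3.1 (proof: grouping of walks at a rhombus; here at a pair of rhombi)] -/
theorem exactDominoVertexRelationV_of_dominoRowsV (ht : t ≠ 0) (h1 : W.u₁ = 0) (hrows : DominoRowsV W t c) :
    ExactDominoVertexRelationV W t c := by
  classical
  intro Dl a f hf hf' ha
  obtain ⟨rS, rW, rE, rW', rE', rN'⟩ := hrows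
  set γ₂ := c 3 - innerUp W t c with hγ₂
  have hsplit : innerUp W t c + γ₂ = c 3 := by rw [hγ₂]; ring
  have hDc : downCoeff c (innerUp W t c) = dressDown W t c := rfl
  rw [dominoFunctionalV_eq_add W t c Dl a f hsplit, hDc,
    vertexFunctional_eq_sum_freshRow ht h1 (dressDown W t c) hf ha,
    vertexFunctional_eq_sum_freshRow ht h1 (upCoeff c γ₂) hf' ha]
  have eL : (∑ ω ∈ setArr Dl a f, if ω.2.kindsIn f = [] then
      extW W ω.2 f * t ^ quarterTurnsL ω.2.mids * plaqRow W t (dressDown W t c) ω.1 else 0) =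
      plaqRow W t (dressDown W t c) .N * ∑ ω ∈ setArr Dl a f, if ω.2.kindsIn f = [] ∧ ω.1 = .N then
        extW W ω.2 f * t ^ quarterTurnsL ω.2.mids else 0 := by
    rw [Finset.mul_sum]
    refine Finset.sum_congr rfl fun ω _ => ?_
    obtain ⟨s, γ⟩ := ω
    dsimp only
    by_cases hK : γ.kindsIn f = []
    · rw [if_pos hK]
      by_cases hp : s = .N
      · subst hp
        rw [if_pos (show γ.kindsIn f = [] ∧ Side.N = Side.N from ⟨hK, rfl⟩)]; ring
      · rw [if_neg (show ¬(γ.kindsIn f = [] ∧ s = Side.N) from fun hc => hp hc.2), mul_zero]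
        have h0 : plaqRow W t (dressDown W t c) s = 0 := by
          cases s
          · exact rW
          · exact rE
          · exact rS
          · exact absurd rfl hp
        rw [h0, mul_zero]
    · rw [if_neg hK, if_neg (show ¬(γ.kindsIn f = [] ∧ s = Side.N) from fun hc => hK hc.1), mul_zero]
  have rowU : ∀ p : Side, plaqRow W t (upCoeff c γ₂) p =
      plaqRow W t (dressUp W t c) p + (γ₂ - innerDown W t c) * (arcW W (arcKind p .S) * t ^ qTurn p .S) := by
    intro p
    rw [plaqRow_eq, plaqRow_eq]
    simp only [upCoeff, dressUp, Matrix.cons_val_zero, Matrix.cons_val_one, Matrix.head_cons,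
      Matrix.cons_val_two, Matrix.tail_cons, Matrix.cons_val_three]
    ring
  have rowUS : plaqRow W t (upCoeff c γ₂) .S = 0 := by
    have e1 := plaqRow_eq W t (upCoeff c γ₂) .S
    have e2 := plaqRow_eq W t ![c 5, c 6, c 4, c 3] .S
    rw [e1, hγ₂, innerUp, e2]
    simp only [upCoeff, Matrix.cons_val_zero, Matrix.cons_val_one, Matrix.head_cons,
      Matrix.cons_val_two, Matrix.tail_cons, Matrix.cons_val_three, arcKind, arcW, qTurn, zpow_zero]
    ring
  have eR : (∑ ω ∈ setArr Dl a (north f), if ω.2.kindsIn (north f) = [] then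
      extW W ω.2 (north f) * t ^ quarterTurnsL ω.2.mids * plaqRow W t (upCoeff c γ₂) ω.1 else 0) =
      (γ₂ - innerDown W t c) * ∑ ω ∈ setArr Dl a (north f), if ω.2.kindsIn (north f) = [] ∧ ω.1 ≠ .S then
        extW W ω.2 (north f) * t ^ quarterTurnsL ω.2.mids * (arcW W (arcKind ω.1 .S) * t ^ qTurn ω.1 .S)
        else 0 := by
    rw [Finset.mul_sum]
    refine Finset.sum_congr rfl fun ω _ => ?_
    obtain ⟨s, γ⟩ := ω
    dsimp only
    by_cases hK : γ.kindsIn (north f) = []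
    · rw [if_pos hK]
      by_cases hp : s = .S
      · subst hp
        rw [if_neg (show ¬(γ.kindsIn (north f) = [] ∧ Side.S ≠ Side.S) from fun hc => hc.2 rfl), rowUS,
          mul_zero, mul_zero]
      · rw [if_pos (show γ.kindsIn (north f) = [] ∧ s ≠ Side.S from ⟨hK, hp⟩), rowU s]
        have h0 : plaqRow W t (dressUp W t c) s = 0 := by
          cases s
          · exact rW'
          · exact rE'
          · exact absurd rfl hp
          · exact rN'
        rw [h0, zero_add]
        ring
    · rw [if_neg hK, if_neg (show ¬(γ.kindsIn (north f) = [] ∧ s ≠ Side.S) from fun hc => hK hc.1),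
        mul_zero]
  have rowDN : plaqRow W t (dressDown W t c) .N = innerDown W t c - γ₂ := by
    have e1 := plaqRow_eq W t (dressDown W t c) .N
    have e2 := plaqRow_eq W t ![c 2, c 3, c 1, c 0] .N
    rw [e1, hγ₂, innerDown, e2]
    simp only [dressDown, Matrix.cons_val_zero, Matrix.cons_val_one, Matrix.head_cons,
      Matrix.cons_val_two, Matrix.tail_cons, Matrix.cons_val_three, arcKind, arcW, qTurn, zpow_zero]
    ring
  rw [eL, eR, rowDN, sum_fresh_sharedV_eq ht h1 hf hf' ha]
  ring

/-- ★★ The same on the mirror branch `u₂ = 0`. [cite: Glazman2015WeightedSAW, Lemma 3.1 (proof: grouping of walks at a rhombus)] -/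
theorem exactDominoVertexRelationV_of_dominoRowsV_mirror (ht : t ≠ 0) (h2 : W.u₂ = 0)
    (hrows : DominoRowsV W t c) : ExactDominoVertexRelationV W t c := by
  classical
  intro Dl a f hf hf' ha
  obtain ⟨rS, rW, rE, rW', rE', rN'⟩ := hrows
  set γ₂ := c 3 - innerUp W t c with hγ₂
  have hsplit : innerUp W t c + γ₂ = c 3 := by rw [hγ₂]; ring
  have hDc : downCoeff c (innerUp W t c) = dressDown W t c := rfl
  rw [dominoFunctionalV_eq_add W t c Dl a f hsplit, hDc,
    vertexFunctional_eq_sum_freshRow_mirror ht h2 (dressDown W t c) hf ha,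
    vertexFunctional_eq_sum_freshRow_mirror ht h2 (upCoeff c γ₂) hf' ha]
  have eL : (∑ ω ∈ setArr Dl a f, if ω.2.kindsIn f = [] then
      extW W ω.2 f * t ^ quarterTurnsL ω.2.mids * plaqRow W t (dressDown W t c) ω.1 else 0) =
      plaqRow W t (dressDown W t c) .N * ∑ ω ∈ setArr Dl a f, if ω.2.kindsIn f = [] ∧ ω.1 = .N then
        extW W ω.2 f * t ^ quarterTurnsL ω.2.mids else 0 := by
    rw [Finset.mul_sum]
    refine Finset.sum_congr rfl fun ω _ => ?_
    obtain ⟨s, γ⟩ := ω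
    dsimp only
    by_cases hK : γ.kindsIn f = []
    · rw [if_pos hK]
      by_cases hp : s = .N
      · subst hp
        rw [if_pos (show γ.kindsIn f = [] ∧ Side.N = Side.N from ⟨hK, rfl⟩)]; ring
      · rw [if_neg (show ¬(γ.kindsIn f = [] ∧ s = Side.N) from fun hc => hp hc.2), mul_zero]
        have h0 : plaqRow W t (dressDown W t c) s = 0 := by
          cases s
          · exact rW
          · exact rE
          · exact rS
          · exact absurd rfl hp
        rw [h0, mul_zero]
    · rw [if_neg hK, if_neg (show ¬(γ.kindsIn f = [] ∧ s = Side.N) from fun hc => hK hc.1), mul_zero]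
  have rowU : ∀ p : Side, plaqRow W t (upCoeff c γ₂) p =
      plaqRow W t (dressUp W t c) p + (γ₂ - innerDown W t c) * (arcW W (arcKind p .S) * t ^ qTurn p .S) := by
    intro p
    rw [plaqRow_eq, plaqRow_eq]
    simp only [upCoeff, dressUp, Matrix.cons_val_zero, Matrix.cons_val_one, Matrix.head_cons,
      Matrix.cons_val_two, Matrix.tail_cons, Matrix.cons_val_three]
    ring
  have rowUS : plaqRow W t (upCoeff c γ₂) .S = 0 := by
    have e1 := plaqRow_eq W t (upCoeff c γ₂) .S
    have e2 := plaqRow_eq W t ![c 5, c 6, c 4, c 3] .S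
    rw [e1, hγ₂, innerUp, e2]
    simp only [upCoeff, Matrix.cons_val_zero, Matrix.cons_val_one, Matrix.head_cons,
      Matrix.cons_val_two, Matrix.tail_cons, Matrix.cons_val_three, arcKind, arcW, qTurn, zpow_zero]
    ring
  have eR : (∑ ω ∈ setArr Dl a (north f), if ω.2.kindsIn (north f) = [] then
      extW W ω.2 (north f) * t ^ quarterTurnsL ω.2.mids * plaqRow W t (upCoeff c γ₂) ω.1 else 0) =
      (γ₂ - innerDown W t c) * ∑ ω ∈ setArr Dl a (north f), if ω.2.kindsIn (north f) = [] ∧ ω.1 ≠ .S then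
        extW W ω.2 (north f) * t ^ quarterTurnsL ω.2.mids * (arcW W (arcKind ω.1 .S) * t ^ qTurn ω.1 .S)
        else 0 := by
    rw [Finset.mul_sum]
    refine Finset.sum_congr rfl fun ω _ => ?_
    obtain ⟨s, γ⟩ := ω
    dsimp only
    by_cases hK : γ.kindsIn (north f) = []
    · rw [if_pos hK]
      by_cases hp : s = .S
      · subst hp
        rw [if_neg (show ¬(γ.kindsIn (north f) = [] ∧ Side.S ≠ Side.S) from fun hc => hc.2 rfl), rowUS,
          mul_zero, mul_zero]
      · rw [if_pos (show γ.kindsIn (north f) = [] ∧ s ≠ Side.S from ⟨hK, hp⟩), rowU s]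
        have h0 : plaqRow W t (dressUp W t c) s = 0 := by
          cases s
          · exact rW'
          · exact rE'
          · exact absurd rfl hp
          · exact rN'
        rw [h0, zero_add]
        ring
    · rw [if_neg hK, if_neg (show ¬(γ.kindsIn (north f) = [] ∧ s ≠ Side.S) from fun hc => hK hc.1),
        mul_zero]
  have rowDN : plaqRow W t (dressDown W t c) .N = innerDown W t c - γ₂ := by
    have e1 := plaqRow_eq W t (dressDown W t c) .N
    have e2 := plaqRow_eq W t ![c 2, c 3, c 1, c 0] .N
    rw [e1, hγ₂, innerDown, e2]
    simp only [dressDown, Matrix.cons_val_zero, Matrix.cons_val_one, Matrix.head_cons,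
      Matrix.cons_val_two, Matrix.tail_cons, Matrix.cons_val_three, arcKind, arcW, qTurn, zpow_zero]
    ring
  rw [eL, eR, rowDN, sum_fresh_sharedV_eq_mirror ht h2 hf hf' ha]
  ring

/-- ★★ **The vertical domino identity on `{u₁ = 0}`** with the vector `branchDominoCoeffMirror u₂ v t`.
[cite: GlazmanManolescu2019, Lemma 2.1 (shape of a local relation)] [cite: JansevanRensburg2015, §4.6 (Temperley method)] -/
theorem exactDominoVertexRelationV_branch (W : CWeights) {t : ℂ} (ht : t ≠ 0) (h1 : W.u₁ = 0) :
    ExactDominoVertexRelationV W t (branchDominoCoeffMirror W.u₂ W.v t) :=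
  exactDominoVertexRelationV_of_dominoRowsV ht h1 (dominoRowsV_branch ht h1)

/-- ★★ **The vertical domino identity on `{u₂ = 0}`** with the vector `branchDominoCoeff u₁ v t`.
[cite: GlazmanManolescu2019, Lemma 2.1 (shape of a local relation)] [cite: JansevanRensburg2015, §4.6 (Temperley method)] -/
theorem exactDominoVertexRelationV_mirrorBranch (W : CWeights) {t : ℂ} (ht : t ≠ 0) (h2 : W.u₂ = 0) :
    ExactDominoVertexRelationV W t (branchDominoCoeff W.u₁ W.v t) :=
  exactDominoVertexRelationV_of_dominoRowsV_mirror ht h2 (dominoRowsV_mirrorBranch ht h2)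

/-- ★ **Vertical domino class ⊋ plaquette class** on `{u₁ = 0}` off the quartic.
[cite: Glazman2015WeightedSAW, Lemma 3.1 (the one-plaquette weight classification)] -/
theorem dominoV_not_plaquette (W : CWeights) {t : ℂ} (ht : t ≠ 0) (h1 : W.u₁ = 0)
    (hq : (1 + W.v - W.u₂) * (1 + W.v + W.u₂) * (1 - W.v - W.u₂) * (1 - W.v + W.u₂) ≠ 0) :
    (∃ c : Fin 7 → ℂ, c ≠ 0 ∧ ExactDominoVertexRelationV W t c) ∧
      ¬∃ c : Fin 4 → ℂ, c ≠ 0 ∧ ExactPlaquetteVertexRelation W t c := by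
  refine ⟨⟨branchDominoCoeffMirror W.u₂ W.v t, branchDominoCoeffMirror_ne_zero ht ?_,
    exactDominoVertexRelationV_branch W ht h1⟩, ?_⟩
  · rintro (⟨hv, hu⟩ | ⟨hu, hv⟩)
    · apply hq; rw [hv]
      have : W.u₂ ^ 2 - 1 = 0 := by rw [hu]; ring
      linear_combination (W.u₂ ^ 2 - 1) * this
    · apply hq; rw [hu]
      have : W.v ^ 2 - 1 = 0 := by rw [hv]; ring
      linear_combination (W.v ^ 2 - 1) * this
  · rw [exactPlaquetteVertexRelation_iff_quartic_of_u₁_eq_zero W ht h1]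
    exact hq

/-- ★ **Vertical domino class ⊋ plaquette class** on `{u₂ = 0}` off the quartic.
[cite: Glazman2015WeightedSAW, Lemma 3.1 (the one-plaquette weight classification)] -/
theorem dominoV_not_plaquette_mirror (W : CWeights) {t : ℂ} (ht : t ≠ 0) (h2 : W.u₂ = 0)
    (hq : (1 + W.v - W.u₁) * (1 + W.v + W.u₁) * (1 - W.v - W.u₁) * (1 - W.v + W.u₁) ≠ 0) :
    (∃ c : Fin 7 → ℂ, c ≠ 0 ∧ ExactDominoVertexRelationV W t c) ∧
      ¬∃ c : Fin 4 → ℂ, c ≠ 0 ∧ ExactPlaquetteVertexRelation W t c := by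
  refine ⟨⟨branchDominoCoeff W.u₁ W.v t, branchDominoCoeff_ne_zero ht ?_,
    exactDominoVertexRelationV_mirrorBranch W ht h2⟩, ?_⟩
  · rintro (⟨hv, hu⟩ | ⟨hu, hv⟩)
    · apply hq; rw [hv]
      have : W.u₁ ^ 2 - 1 = 0 := by rw [hu]; ring
      linear_combination (W.u₁ ^ 2 - 1) * this
    · apply hq; rw [hu]
      have : W.v ^ 2 - 1 = 0 := by rw [hv]; ring
      linear_combination (W.v ^ 2 - 1) * this
  · rw [exactPlaquetteVertexRelation_iff_quartic_of_u₂_eq_zero W ht h2]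
    exact hq

end Vertical

/-! ## Two-sided: the vertical domino class of the branches -/

section TwoSidedV

variable {W : CWeights} {t : ℂ} {c : Fin 7 → ℂ}

/-- ★★ **Two-sided on the branch `u₁ = 0`** (vertical): at phase `t ≠ 0`, `c ∈ ℂ⁷` is an exact vertical
domino relation iff the six vertical rows vanish (necessity for every `W`: `PlaquetteWalkDominoRigidityVertical`;
sufficiency: the transfer argument of this file). [cite: Glazman2015WeightedSAW, Lemma 3.1 (the one-rhombus analogue: identity iff the linear system)] -/
theorem exactDominoVertexRelationV_iff_dominoRowsV_of_u₁_eq_zero (ht : t ≠ 0) (h1 : W.u₁ = 0) :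
    ExactDominoVertexRelationV W t c ↔ DominoRowsV W t c :=
  ⟨fun h => dominoRowsV_of_exactDominoVertexRelationV h ht,
    fun h => exactDominoVertexRelationV_of_dominoRowsV ht h1 h⟩

/-- ★★ **Two-sided on the mirror branch `u₂ = 0`** (vertical). [cite: Glazman2015WeightedSAW, Lemma 3.1 (the one-rhombus analogue: identity iff the linear system)] -/
theorem exactDominoVertexRelationV_iff_dominoRowsV_of_u₂_eq_zero (ht : t ≠ 0) (h2 : W.u₂ = 0) :
    ExactDominoVertexRelationV W t c ↔ DominoRowsV W t c :=
  ⟨fun h => dominoRowsV_of_exactDominoVertexRelationV h ht,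
    fun h => exactDominoVertexRelationV_of_dominoRowsV_mirror ht h2 h⟩

end TwoSidedV

/-! ## The named statement -/

section Named

/-- **Barrier `PlaquetteWalkDominoIdentityVertical`** (named statement): on both directed branches of the
five-weight plaquette walk on `ℤ²` — `u₁ = 0` and `u₂ = 0`, every other weight complex, every phase `t ≠ 0` —
the constant vector `branchDominoCoeffMirror u₂ v t`, resp. `branchDominoCoeff u₁ v t`, is an exact VERTICAL
domino relation at every vertical domino of every finite face list for every boundary root; each vector is
nonzero off the two quartic points of its branch. A THEOREM of this file
(`PlaquetteWalkDominoIdentityVertical_holds`); with `PlaquetteWalkDominoIdentity` all four directed domino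
identities are kernel theorems.

BARRIER (structured block, D-0021):
- technique_class: two-plaquette (vertical domino) linear vertex relations `Σ_{s<7} c_s F(z_s) = 0` with a constant `c ∈ ℂ⁷` over the seven sides of two vertically adjacent plaquettes, GM plaquette walk on `ℤ²`, complex weights, phase `t ≠ 0`, every vertical domino of every finite face list, every boundary root — `ExactDominoVertexRelationV W t c`
- blocks: nothing — it PROVIDES identities on the hyperplanes `{u₁ = 0}`, `{u₂ = 0}`, where off the quartics `(1 ± v)² = u²` no one-plaquette relation exists (`dominoV_not_plaquette(_mirror)`)
- because: directedness on the branches (no walk doubles all its corner plaquettes, F12 ed.6), fresh-arrival rows (`vertexFunctional_eq_sum_freshRow`), transfer through the vertical shared side (`sum_fresh_sharedV_eq`), six vanishing vertical rows (`dominoRowsV_branch` / `…_mirrorBranch`)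
- evasions_known: none needed (positive statement); nothing is claimed for `u₁u₂ ≠ 0` here (see `PlaquetteWalkDominoGenericTriviality` for the horizontal generic triviality)
- scope_caveats: exact constant-coefficient identities of the five-weight class only; `t = 0` excluded
- status: established — `PlaquetteWalkDominoIdentityVertical_holds`; mechanism folklore (Temperley) [cite: JansevanRensburg2015, §4.6]; typed statements the venture lane's (NEW-IN-WRITING, modest)
[cite: GlazmanManolescu2019, Lemma 2.1] -/
def _root_.Literature.Barriers.CriticalPhenomena.PlaquetteWalkDominoIdentityVertical : Prop :=
  (∀ (W : CWeights) (t : ℂ), t ≠ 0 → W.u₁ = 0 →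
    ExactDominoVertexRelationV W t (branchDominoCoeffMirror W.u₂ W.v t) ∧
      (¬((W.v = 0 ∧ W.u₂ ^ 2 = 1) ∨ (W.u₂ = 0 ∧ W.v ^ 2 = 1)) → branchDominoCoeffMirror W.u₂ W.v t ≠ 0)) ∧
  (∀ (W : CWeights) (t : ℂ), t ≠ 0 → W.u₂ = 0 →
    ExactDominoVertexRelationV W t (branchDominoCoeff W.u₁ W.v t) ∧
      (¬((W.v = 0 ∧ W.u₁ ^ 2 = 1) ∨ (W.u₁ = 0 ∧ W.v ^ 2 = 1)) → branchDominoCoeff W.u₁ W.v t ≠ 0))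

/-- **`PlaquetteWalkDominoIdentityVertical` holds.** [cite: GlazmanManolescu2019, Lemma 2.1] -/
theorem _root_.Literature.Barriers.CriticalPhenomena.PlaquetteWalkDominoIdentityVertical_holds :
    PlaquetteWalkDominoIdentityVertical :=
  ⟨fun W _ ht h1 => ⟨exactDominoVertexRelationV_branch W ht h1, fun h => branchDominoCoeffMirror_ne_zero ht h⟩,
    fun W _ ht h2 => ⟨exactDominoVertexRelationV_mirrorBranch W ht h2,
      fun h => branchDominoCoeff_ne_zero ht h⟩⟩

end Named

end PlaquetteWalk

end Literature.Barriers.CriticalPhenomena
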